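import Summits.ResolutionOfSingularities.ResolutionOfSingularities.Theorems.FrobeniusLadderFInjectiveMacaulayficationKLocCellSound
import HarnessLib

/-!
# PILOT G2 cells of `T⁽⁴⁾` at `p = 7` (crux `FInjectiveMacaulayfication`, road B feasibility number, R12.11(d) / R12.12(b))

[OURS · L1 W4.5a] Support file for crux stmt-ResolutionOfSingularities-15315 (seat table v13, stub-6).  Two charts of res-L1-w45a-tri-1's
`tools/certs/cert-T4-own-p7.json` (schema toric-cert-v1; `T⁽⁴⁾ = z² + (y²+x³)³ + w⁷ + v⁸ + x¹²`, variables `(x,y,z,w,v) = (Y 0,…,Y 4)` after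
the chart substitution): chart 0 (cone [0,2,3,7,20], strata {0}, {3}, {4}, all `const`) and chart 213 (cone [2,3,4,10,75], stratum {4}
`empty`; its stratum {3} is `gb-unit` and waits for tri-1's Gröbner cofactors).  Each theorem is the §3 hypothesis
`∀ S ∈ SS, ∃ L rr t t₀, Nodup ∧ (< p) ∧ split ∧ cofactors` of `L/w45a/ToricCertSig.lean` v1.2 (`KLocCell`) for the chart polynomial
`g = KLocCellKit.evalL K G` (8 terms), obtained from `KLocCellKit.klocCells_of_check` by ONE `decide +kernel`: the kernel computes
`g⁶` (966 terms), its 528-class residue split and the cofactor normal forms.  MEASURED: ≈ 45 s per chart, default heartbeats — the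
number R12.11(d) asked for (537 charts ⇒ ≈ 7 h of farm kernel time in ≈ 110 files of 5 charts).
No definition is declared; the `decide` is a computational certificate check; AI-written, weaker than expert review; no statement of
[claim: Hironaka2017] is used. [folklore]
-/

-- single-problem summit: the doubled namespace component is forced
set_option linter.dupNamespace false

noncomputable section

namespace Summit.ResolutionOfSingularities.ResolutionOfSingularities.Theorems.FInjectiveMacaulayfication.T4KLocPilot

open MvPolynomial
open Summit.ResolutionOfSingularities.ResolutionOfSingularities.Theorems.FInjectiveMacaulayfication

/-- **Chart 0** (cone [0,2,3,7,20]; `V` rows (56,84,252,72,63), e₁, e₂, (24,36,108,31,27), (25,38,112,32,28); `d = (504,0,0,216,224)`): the G2 cells of its three strata over 0, `S = {0}, {3}, {4}` (all `const`, residue 0, value 1). [folklore] -/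
theorem chart0_cells (K : Type) [Field K] [CharP K 7] :
    ∀ S ∈ (([((({0} : Finset (Fin 5))), (([((![0, 0, 0, 0, 0] : Fin 5 → ℕ), [((1 : ℤ), (![0, 0, 0, 0, 0] : Fin 5 → ℕ))])] : List ((Fin 5 → ℕ) × List (ℤ × (Fin 5 → ℕ))))), ((![[], [], [], [], []] : Fin 5 → List (ℤ × (Fin 5 → ℕ)))), (([] : List (ℤ × (Fin 5 → ℕ))))),
      ((({3} : Finset (Fin 5))), (([((![0, 0, 0, 0, 0] : Fin 5 → ℕ), [((1 : ℤ), (![0, 0, 0, 0, 0] : Fin 5 → ℕ))])] : List ((Fin 5 → ℕ) × List (ℤ × (Fin 5 → ℕ))))), ((![[], [], [], [], []] : Fin 5 → List (ℤ × (Fin 5 → ℕ)))), (([] : List (ℤ × (Fin 5 → ℕ))))),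
      ((({4} : Finset (Fin 5))), (([((![0, 0, 0, 0, 0] : Fin 5 → ℕ), [((1 : ℤ), (![0, 0, 0, 0, 0] : Fin 5 → ℕ))])] : List ((Fin 5 → ℕ) × List (ℤ × (Fin 5 → ℕ))))), ((![[], [], [], [], []] : Fin 5 → List (ℤ × (Fin 5 → ℕ)))), (([] : List (ℤ × (Fin 5 → ℕ)))))] : List (Finset (Fin 5) × List ((Fin 5 → ℕ) × List (ℤ × (Fin 5 → ℕ))) × (Fin 5 → List (ℤ × (Fin 5 → ℕ))) ×
        List (ℤ × (Fin 5 → ℕ))))).map Prod.fst,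
      ∃ (L : List ((Fin 5 →₀ ℕ) × MvPolynomial (Fin 5) K)) (rr : List (MvPolynomial (Fin 5) K))
        (t : Fin 5 → MvPolynomial (Fin 5) K) (t₀ : MvPolynomial (Fin 5) K),
        (L.map Prod.fst).Nodup ∧ (∀ e ∈ L, ∀ i : Fin 5, e.1 i < 7) ∧
        KLocCellKit.evalL K ([((1 : ℤ), (![0, 0, 0, 0, 0] : Fin 5 → ℕ)), ((1 : ℤ), (![0, 0, 2, 0, 0] : Fin 5 → ℕ)), ((1 : ℤ), (![0, 0, 0, 1, 0] : Fin 5 → ℕ)), ((1 : ℤ), (![0, 0, 0, 0, 1] : Fin 5 → ℕ)), ((3 : ℤ), (![0, 2, 0, 0, 2] : Fin 5 → ℕ)), ((3 : ℤ), (![0, 4, 0, 0, 3] : Fin 5 → ℕ)), ((1 : ℤ), (![0, 6, 0, 0, 4] : Fin 5 → ℕ)), ((1 : ℤ), (![168, 0, 0, 72, 76] : Fin 5 → ℕ))] : List (ℤ × (Fin 5 → ℕ))) ^ (7 - 1) =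
          (L.map fun e => MvPolynomial.monomial e.1 (1 : K) * MvPolynomial.expand 7 e.2).sum ∧
        (1 : MvPolynomial (Fin 5) K) = (List.zipWith (fun r e => r * MvPolynomial.expand 7 e.2) rr L).sum +
          ∑ i ∈ S, t i * MvPolynomial.X i + t₀ * KLocCellKit.evalL K ([((1 : ℤ), (![0, 0, 0, 0, 0] : Fin 5 → ℕ)), ((1 : ℤ), (![0, 0, 2, 0, 0] : Fin 5 → ℕ)), ((1 : ℤ), (![0, 0, 0, 1, 0] : Fin 5 → ℕ)), ((1 : ℤ), (![0, 0, 0, 0, 1] : Fin 5 → ℕ)), ((3 : ℤ), (![0, 2, 0, 0, 2] : Fin 5 → ℕ)), ((3 : ℤ), (![0, 4, 0, 0, 3] : Fin 5 → ℕ)), ((1 : ℤ), (![0, 6, 0, 0, 4] : Fin 5 → ℕ)), ((1 : ℤ), (![168, 0, 0, 72, 76] : Fin 5 → ℕ))] : List (ℤ × (Fin 5 → ℕ))) :=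
  haveI : Fact (Nat.Prime 7) := ⟨by decide⟩
  KLocCellKit.klocCells_of_check K 7 _ _ (by decide +kernel)

/-- **Chart 213** (cone [2,3,4,10,75]; `V` rows e₁, e₂, e₃, (2,3,9,3,3), (1,2,5,2,2); `d = (0,0,0,18,9)`): the G2 cell of its stratum `S = {4}` (`empty`: `g ≡ 1 mod Y₄`); stratum `{3}` (`gb-unit`) pending cofactors. [folklore] -/
theorem chart213_cell4 (K : Type) [Field K] [CharP K 7] :
    ∀ S ∈ (([((({4} : Finset (Fin 5))), (([] : List ((Fin 5 → ℕ) × List (ℤ × (Fin 5 → ℕ))))), ((![[], [], [], [], [((4 : ℤ), (![2, 0, 0, 0, 0] : Fin 5 → ℕ)), ((6 : ℤ), (![0, 2, 0, 0, 0] : Fin 5 → ℕ)), ((4 : ℤ), (![4, 0, 0, 0, 1] : Fin 5 → ℕ)), ((6 : ℤ), (![6, 0, 0, 0, 2] : Fin 5 → ℕ)), ((6 : ℤ), (![0, 0, 0, 6, 2] : Fin 5 → ℕ)), ((6 : ℤ), (![0, 0, 7, 3, 4] : Fin 5 → ℕ)), ((6 : ℤ), (![0, 0, 0, 6, 6] :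 Fin 5 → ℕ))]] : Fin 5 → List (ℤ × (Fin 5 → ℕ)))), (([((1 : ℤ), (![0, 0, 0, 0, 0] : Fin 5 → ℕ))] : List (ℤ × (Fin 5 → ℕ)))))] : List (Finset (Fin 5) × List ((Fin 5 → ℕ) × List (ℤ × (Fin 5 → ℕ))) × (Fin 5 → List (ℤ × (Fin 5 → ℕ))) ×
        List (ℤ × (Fin 5 → ℕ))))).map Prod.fst,
      ∃ (L : List ((Fin 5 →₀ ℕ) × MvPolynomial (Fin 5) K)) (rr : List (MvPolynomial (Fin 5) K))
        (t : Fin 5 → MvPolynomial (Fin 5) K) (t₀ : MvPolynomial (Fin 5) K),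
        (L.map Prod.fst).Nodup ∧ (∀ e ∈ L, ∀ i : Fin 5, e.1 i < 7) ∧
        KLocCellKit.evalL K ([((1 : ℤ), (![0, 0, 0, 0, 0] : Fin 5 → ℕ)), ((3 : ℤ), (![2, 0, 0, 0, 1] : Fin 5 → ℕ)), ((1 : ℤ), (![0, 2, 0, 0, 1] : Fin 5 → ℕ)), ((3 : ℤ), (![4, 0, 0, 0, 2] : Fin 5 → ℕ)), ((1 : ℤ), (![6, 0, 0, 0, 3] : Fin 5 → ℕ)), ((1 : ℤ), (![0, 0, 0, 6, 3] : Fin 5 → ℕ)), ((1 : ℤ), (![0, 0, 7, 3, 5] : Fin 5 → ℕ)), ((1 : ℤ), (![0, 0, 0, 6, 7] : Fin 5 → ℕ))] : List (ℤ × (Fin 5 → ℕ))) ^ (7 - 1) =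
          (L.map fun e => MvPolynomial.monomial e.1 (1 : K) * MvPolynomial.expand 7 e.2).sum ∧
        (1 : MvPolynomial (Fin 5) K) = (List.zipWith (fun r e => r * MvPolynomial.expand 7 e.2) rr L).sum +
          ∑ i ∈ S, t i * MvPolynomial.X i + t₀ * KLocCellKit.evalL K ([((1 : ℤ), (![0, 0, 0, 0, 0] : Fin 5 → ℕ)), ((3 : ℤ), (![2, 0, 0, 0, 1] : Fin 5 → ℕ)), ((1 : ℤ), (![0, 2, 0, 0, 1] : Fin 5 → ℕ)), ((3 : ℤ), (![4, 0, 0, 0, 2] : Fin 5 → ℕ)), ((1 : ℤ), (![6, 0, 0, 0, 3] : Fin 5 → ℕ)), ((1 : ℤ), (![0, 0, 0, 6, 3] : Fin 5 → ℕ)), ((1 : ℤ), (![0, 0, 7, 3, 5] : Fin 5 → ℕ)), ((1 : ℤ), (![0, 0, 0, 6, 7] : Fin 5 → ℕ))] : List (ℤ × (Fin 5 → ℕ))) :=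
  haveI : Fact (Nat.Prime 7) := ⟨by decide⟩
  KLocCellKit.klocCells_of_check K 7 _ _ (by decide +kernel)

end Summit.ResolutionOfSingularities.ResolutionOfSingularities.Theorems.FInjectiveMacaulayfication.T4KLocPilot

end
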